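import Summits.MatrixMultiplication.OmegaCensus.STPPVosperSlackPairingGauge

/-!
# ω-census (abelian STPP census): the FINSET-VALUED anchor listing of exact covers with holes — kernel-reducible (no sorting) (kernel tool)

HONEST FRAMING (pub-omega census; verbatim): lottery ticket; floor = certified bounds/negative ranges.
Census STRUCTURE (seat pub-omega-stpp-2 gen 26, 2026-08-28; RULING L37-135), family (b2).  `anchorsFk` (`STPPVosperSlackPairingGauge.lean`) iterates the
pattern through `Finset.sort`, whose well-founded recursion the kernel does not unfold (`decide +kernel` gets stuck — farm probe).  `anchorSetsFk` is the
same search returning a `Finset (Finset ℕ)` built with `biUnion` / `image`; `anchorSetsFk_complete`, `anchorSetsFk_of_zmod_tiling`, `anchorSetsFk_blockSum2` are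
the completeness and transport statements of the list version, verbatim.  Used by `stageBF` (`STPPVosperSlackPairingCoreBF.lean`).  Nothing here is progress on `ω`.

References: H. Cohn, R. Kleinberg, B. Szegedy, C. Umans, FOCS 2005 (arXiv:math/0511460), Def. 5.1.
-/

open Finset
open scoped Pointwise

namespace Summit.MatrixMultiplication.OmegaCensus.CubeNB

open Literature.Computability.AlgebraicComplexity
open Literature.Combinatorics.Additive
open Summit.MatrixMultiplication.OmegaCensus.STPPKneser

/-! ## §1 Finset-valued anchor listing -/

section Anchors

/-- **Anchor sets of all exact covers with ≤ `k` holes, as a finset of finsets** (same search as `coverByFk` / `anchorsFk`, kernel-reducible: `biUnion`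
over the pattern instead of iterating a sorted list). [folklore] -/
def anchorSetsFk (p : ℕ) (T : Finset ℕ) : ℕ → ℕ → Finset ℕ → Finset (Finset ℕ)
  | 0, _, X => if X = ∅ then {∅} else ∅
  | fuel + 1, k, X =>
    if h : X.Nonempty then
      (if 0 < k then anchorSetsFk p T fuel (k - 1) (X.erase (X.min' h)) else ∅) ∪
      T.biUnion fun g =>
        if T.image (fun t => ((X.min' h + p - g) % p + t) % p) ⊆ X then
          (anchorSetsFk p T fuel k (X \ T.image fun t => ((X.min' h + p - g) % p + t) % p)).image fun Y => insert ((X.min' h + p - g) % p) Y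
        else ∅
    else {∅}

/-- **Completeness of the anchor listing.**  If `X = ⋃_{i ∈ s} ((g i + T) mod p) ∪ HS` with pairwise disjoint tiles, `HS` disjoint from them,
`g i < p`, `T` non-empty and below `p`, `#HS ≤ k`, `#s + #HS ≤ fuel`, then the anchor set `s.image g` is a member of `anchorsFk p T fuel k X`. [folklore] -/
theorem anchorSetsFk_complete (p : ℕ) (T : Finset ℕ) (hTne : T.Nonempty) (hT : ∀ t ∈ T, t < p) {ι : Type*} [DecidableEq ι] (g : ι → ℕ) :
    ∀ (fuel k : ℕ) (s : Finset ι) (HS : Finset ℕ), #s + #HS ≤ fuel → #HS ≤ k → (∀ i ∈ s, g i < p) →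
      (s : Set ι).PairwiseDisjoint (fun i => T.image fun t => (g i + t) % p) →
      (∀ i ∈ s, Disjoint (T.image fun t => (g i + t) % p) HS) →
      s.image g ∈ anchorSetsFk p T fuel k ((s.biUnion fun i => T.image fun t => (g i + t) % p) ∪ HS) := by
  intro fuel
  induction fuel with
  | zero =>
    intro k s HS hf _ _ _ _
    have hs : s = ∅ := Finset.card_eq_zero.1 (by omega)
    have hH : HS = ∅ := Finset.card_eq_zero.1 (by omega)
    subst hs; subst hH
    simp [anchorSetsFk]
  | succ f ih =>
    intro k s HS hf hk hg hdisj hdisjH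
    set X := (s.biUnion fun i => T.image fun t => (g i + t) % p) ∪ HS with hX
    by_cases hne : X.Nonempty
    · rw [anchorSetsFk, dif_pos hne, Finset.mem_union]
      set x₀ := X.min' hne with hx₀
      have hx₀mem : x₀ ∈ X := Finset.min'_mem X hne
      rcases Finset.mem_union.1 hx₀mem with hx₀T | hx₀H
      · right
        rw [Finset.mem_biUnion]
        obtain ⟨i₀, hi₀, hx₀i⟩ := Finset.mem_biUnion.1 hx₀T
        obtain ⟨t₀, ht₀, hx₀t⟩ := Finset.mem_image.1 hx₀i
        have hgi₀ : g i₀ < p := hg i₀ hi₀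
        have ht₀p : t₀ < p := hT t₀ ht₀
        have hctr : (x₀ + p - t₀) % p = g i₀ := by
          rw [← hx₀t]
          have h1 : (g i₀ + t₀) % p + p - t₀ = (g i₀ + t₀) % p + (p - t₀) := by omega
          rw [h1, Nat.add_mod, Nat.mod_mod, ← Nat.add_mod, show g i₀ + t₀ + (p - t₀) = g i₀ + p by omega, Nat.add_mod_right,
            Nat.mod_eq_of_lt hgi₀]
        refine ⟨t₀, ht₀, ?_⟩
        have hsub : T.image (fun t => ((x₀ + p - t₀) % p + t) % p) ⊆ X := by
          rw [hctr]; exact (Finset.subset_biUnion_of_mem (fun i => T.image fun t => (g i + t) % p) hi₀).trans Finset.subset_union_left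
        rw [if_pos hsub, Finset.mem_image]
        refine ⟨(s.erase i₀).image g, ?_, ?_⟩
        · have hrest : X \ T.image (fun t => ((x₀ + p - t₀) % p + t) % p) =
              ((s.erase i₀).biUnion fun i => T.image fun t => (g i + t) % p) ∪ HS := by
            rw [hctr, hX, ← Finset.insert_erase hi₀, Finset.biUnion_insert, Finset.insert_erase hi₀, Finset.union_assoc,
              Finset.union_sdiff_left, Finset.sdiff_eq_self_iff_disjoint, Finset.disjoint_union_left, Finset.disjoint_biUnion_left]
            refine ⟨fun i hi => ?_, (hdisjH i₀ hi₀).symm⟩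
            exact hdisj (Finset.mem_coe.2 (Finset.mem_of_mem_erase hi)) (Finset.mem_coe.2 hi₀) (Finset.ne_of_mem_erase hi)
          rw [hrest]
          have hspos : 0 < #s := Finset.card_pos.2 ⟨i₀, hi₀⟩
          apply ih
          · rw [Finset.card_erase_of_mem hi₀]; omega
          · exact hk
          · exact fun i hi => hg i (Finset.mem_of_mem_erase hi)
          · exact hdisj.subset (Finset.coe_subset.2 (Finset.erase_subset i₀ s))
          · exact fun i hi => hdisjH i (Finset.mem_of_mem_erase hi)
        · rw [hctr, ← Finset.image_insert, Finset.insert_erase hi₀]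
      · left
        have hHpos : 0 < #HS := Finset.card_pos.2 ⟨x₀, hx₀H⟩
        rw [if_pos (lt_of_lt_of_le hHpos hk)]
        have hrest : X.erase x₀ = (s.biUnion fun i => T.image fun t => (g i + t) % p) ∪ HS.erase x₀ := by
          rw [hX, Finset.erase_union_distrib]
          congr 1
          rw [Finset.erase_eq_of_notMem]
          intro hmem
          obtain ⟨i, hi, hxi⟩ := Finset.mem_biUnion.1 hmem
          exact Finset.disjoint_left.1 (hdisjH i hi) hxi hx₀H
        rw [hrest]
        apply ih
        · rw [Finset.card_erase_of_mem hx₀H]; omega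
        · rw [Finset.card_erase_of_mem hx₀H]; omega
        · exact hg
        · exact hdisj
        · exact fun i hi => (hdisjH i hi).mono_right (Finset.erase_subset _ _)
    · rw [anchorSetsFk, dif_neg hne]
      have hs : s = ∅ := by
        by_contra hs
        obtain ⟨i, hi⟩ := Finset.nonempty_iff_ne_empty.2 hs
        obtain ⟨t, ht⟩ := hTne
        exact hne ⟨(g i + t) % p, Finset.mem_union_left _ (Finset.mem_biUnion.2 ⟨i, hi, Finset.mem_image.2 ⟨t, ht, rfl⟩⟩)⟩
      subst hs
      simp

end Anchors

/-! ## §2 Transport (finset form) -/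

section Transport

variable {p : ℕ} [hp : Fact p.Prime]

/-- **Transport of a tiling with extra points to the finset anchor listing.** [folklore] -/
theorem anchorSetsFk_of_zmod_tiling (TZ : Finset (ZMod p)) (hTZ : TZ.Nonempty) {ι : Type*} [DecidableEq ι] (s : Finset ι) (gz : ι → ZMod p)
    (HZ : Finset (ZMod p)) {fuel k : ℕ} (hfuel : #s + #HZ ≤ fuel) (hk : #HZ ≤ k)
    (hdisj : (s : Set ι).PairwiseDisjoint fun i => TZ.image fun τ => gz i + τ) (hdisjH : ∀ i ∈ s, Disjoint (TZ.image fun τ => gz i + τ) HZ) :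
    s.image (fun i => (gz i).val) ∈
      anchorSetsFk p (TZ.image ZMod.val) fuel k (((s.biUnion fun i => TZ.image fun τ => gz i + τ) ∪ HZ).image ZMod.val) := by
  have hvinj := ZMod.val_injective p
  have himg : ((s.biUnion fun i => TZ.image fun τ => gz i + τ) ∪ HZ).image ZMod.val =
      (s.biUnion fun i => (TZ.image ZMod.val).image fun t => ((gz i).val + t) % p) ∪ HZ.image ZMod.val := by
    rw [Finset.image_union, Finset.biUnion_image]
    congr 1
    exact Finset.biUnion_congr rfl fun i _ => image_val_translate TZ (gz i)
  rw [himg]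
  refine anchorSetsFk_complete p (TZ.image ZMod.val) (hTZ.image _) (fun t ht => ?_) (fun i => (gz i).val) fuel k s (HZ.image ZMod.val)
    (by rw [Finset.card_image_of_injective _ hvinj]; exact hfuel) (by rw [Finset.card_image_of_injective _ hvinj]; exact hk)
    (fun i _ => ZMod.val_lt _) ?_ ?_
  · obtain ⟨τ, -, rfl⟩ := Finset.mem_image.1 ht
    exact ZMod.val_lt τ
  · intro i hi i' hi' hne
    have h := hdisj hi hi' hne
    rw [Function.onFun] at h ⊢
    rw [← image_val_translate, ← image_val_translate]
    exact (Finset.disjoint_image hvinj).2 h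
  · intro i hi
    rw [← image_val_translate]
    exact (Finset.disjoint_image hvinj).2 (hdisjH i hi)

variable {N : ℕ} {A B C : Fin N → Finset (ZMod p)}

/-- **The transported `Cᵢ` is a listed anchor set (finset form).**  Hypotheses of `coverByFk_blockSum2` (block `i` with `−Aᵢ = {s₀ + ε•d : ε ∈ AD}`, `Bᵢ = {β + δ•e′ : δ ∈ BD}`,
`u e′ = 1`, `R ⊇ W` with `#R ≤ #W + k`, `|Cᵢ| + k ≤ fuel`) and `AD`, `BD` non-empty: the set `{(u c + w + u s₀ − u β).val : c ∈ Cᵢ}` is a member of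
`anchorsFk p (patN2 p (u d).val AD BD) fuel k ((u·R + w).val)`. [cite: CohnKleinbergSzegedyUmans2005, Def. 5.1] -/
theorem anchorSetsFk_blockSum2 (hS : IsSTPP A B C) (i : Fin N) {u e' d s₀ β w : ZMod p} (hue : u * e' = 1) {AD BD : Finset ℕ}
    (hADne : AD.Nonempty) (hBDne : BD.Nonempty) (hAD : ∀ ε ∈ AD, ε < p) (hBD : ∀ δ ∈ BD, δ < p)
    (hSn : (A i).image (fun x => (0 : ZMod p) - x) = AD.image fun ε : ℕ => s₀ + ε • d) (hB : B i = BD.image fun δ : ℕ => β + δ • e')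
    {R : Finset (ZMod p)} {k fuel : ℕ}
    (hWR : (((A i) ×ˢ ((B i) ×ˢ (C i))).image fun q : ZMod p × ZMod p × ZMod p => (0 : ZMod p) + q.2.2 - q.1 - q.2.1) ⊆ R)
    (hRk : #R ≤ #((((A i) ×ˢ ((B i) ×ˢ (C i))).image fun q : ZMod p × ZMod p × ZMod p => (0 : ZMod p) + q.2.2 - q.1 - q.2.1)) + k)
    (hfuel : #(C i) + k ≤ fuel) :
    (C i).image (fun c => (u * c + w + u * s₀ - u * β).val) ∈
      anchorSetsFk p (patN2 p (u * d).val AD BD) fuel k ((R.image fun x => u * x + w).image ZMod.val) := by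
  set W := ((A i) ×ˢ ((B i) ×ˢ (C i))).image fun q : ZMod p × ZMod p × ZMod p => (0 : ZMod p) + q.2.2 - q.1 - q.2.1 with hW
  obtain ⟨hWeq, hdisj⟩ := W_eq_biUnion_C hS i
  rw [← hW] at hWeq
  set TZ := (AD ×ˢ BD).image fun εδ : ℕ × ℕ => (εδ.1 : ZMod p) * (u * d) - (εδ.2 : ZMod p) with hTZ
  set gz : ZMod p → ZMod p := fun c => u * c + w + u * s₀ - u * β with hgz
  have hu0 : u ≠ 0 := fun h => by rw [h, zero_mul] at hue; exact zero_ne_one hue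
  have hφinj : Function.Injective (fun x : ZMod p => u * x + w) := affine_injective hu0 w
  have htiles : W.image (fun x => u * x + w) = (C i).biUnion fun c => TZ.image fun τ => gz c + τ := by
    rw [hWeq, Finset.biUnion_image]
    exact Finset.biUnion_congr rfl fun c _ => image_Ctile_affine2 i hue hSn hB c
  have hdisjT : ((C i : Finset (ZMod p)) : Set (ZMod p)).PairwiseDisjoint fun c => TZ.image fun τ => gz c + τ := by
    intro c hc c' hc' hne
    rw [Function.onFun, ← image_Ctile_affine2 i hue hSn hB c, ← image_Ctile_affine2 i hue hSn hB c']
    exact (Finset.disjoint_image hφinj).2 (hdisj hc hc' hne)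
  set HZ := (R \ W).image (fun x => u * x + w) with hHZ
  have hRE : R.image (fun x => u * x + w) = (C i).biUnion (fun c => TZ.image fun τ => gz c + τ) ∪ HZ := by
    rw [← htiles, hHZ, ← Finset.image_union, Finset.union_sdiff_of_subset hWR]
  have hHZcard : #HZ ≤ k := by
    rw [hHZ, Finset.card_image_of_injective _ hφinj, Finset.card_sdiff_of_subset hWR]; omega
  have hdisjH : ∀ c ∈ C i, Disjoint (TZ.image fun τ => gz c + τ) HZ := by
    intro c hc
    rw [← image_Ctile_affine2 i hue hSn hB c, hHZ, Finset.disjoint_image hφinj]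
    refine Finset.disjoint_left.2 fun x hx hx' => (Finset.mem_sdiff.1 hx').2 ?_
    rw [hWeq]
    exact Finset.mem_biUnion.2 ⟨c, hc, hx⟩
  have hTZne : TZ.Nonempty := by
    obtain ⟨ε, hε⟩ := hADne
    obtain ⟨δ, hδ⟩ := hBDne
    exact ⟨_, Finset.mem_image.2 ⟨(ε, δ), Finset.mem_product.2 ⟨hε, hδ⟩, rfl⟩⟩
  rw [hRE, ← image_val_pattern2 hAD hBD]
  exact anchorSetsFk_of_zmod_tiling TZ hTZne (C i) gz HZ (by omega) hHZcard hdisjT hdisjH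

end Transport

end Summit.MatrixMultiplication.OmegaCensus.CubeNB
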